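import Summits.ResolutionOfSingularities.ResolutionOfSingularities.Theorems.WeightedInvariantIota3EpsUpperSemicontinuous
import Summits.ResolutionOfSingularities.ResolutionOfSingularities.Theorems.WeightedInvariantIota3Tie
import Summits.ResolutionOfSingularities.ResolutionOfSingularities.Theorems.WeightedInvariantHypersurfaceCentreAssemblyStalkDict
import Summits.ResolutionOfSingularities.ResolutionOfSingularities.Theorems.WeightedInvariantContactCylinderTransport
import HarnessLib

/-!
# Finiteness of the tie points — the chart dictionary for the scheme step: tie positions, their order and their stratum prime
# read on `Γ(Y, U)_𝔮 ≃ 𝒪_{Y,y}` (door `HypersurfaceCentreConstruction`, stmt-ResolutionOfSingularities-19897, route `WeightedInvariant`,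
# P3 rung `KeyRungGrLE 3 p`, clause (c8)≤3,p for the letter `τ`)

[OURS · L1 W4.3 · cell `res-hironaka`, HUMAN RULING D-0089] Helper file `--supports stmt-ResolutionOfSingularities-19897` (line
`local-engine` of res-L1-w43-plan-1, spec `L/res-type-047/D2-INCHART-SPEC-v3.md` steps (S1)/(S6)).  For an affine open `U` of a scheme
`Y`, a point `y ∈ U` with prime `𝔮 = 𝔭_y ⊆ Γ(Y, U)`, and `f ∈ Γ(Y, ⊤)`, along the canonical `stalkEquiv U hy : Γ(Y, U)_𝔮 ≃+* 𝒪_{Y,y}`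
(`…HypersurfaceCentreAssemblyStalkDict`):
* `TieFinite.isoInvariant_germ_iff_localization` — ANY iso-invariant predicate `P` of `(ring, element)` holds at `(𝒪_{Y,y}, f_y)` iff it
  holds at `(Γ(Y,U)_𝔮, f|_U / 1)`; instances `isTiePosition_germ_iff_localization` (res-type-092's `Iota3.IsTiePosition`, (c6τ)
  `isTiePosition_ringEquiv_iff`) and the `fromSpec q` forms;
* `TieFinite.topStratumPrime_germ_eq_map_iff` — the stratum prime `P₀(𝒪_{Y,y}, f_y)` is the extension of an ideal `P′ ⊆ Γ(Y, U)` iff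
  `P₀(Γ(Y,U)_𝔮, f|_U/1)` is (`ContactCylinder.topStratumPrime_ringEquiv`, res-type-092) — the clause
  `topStratumPrime = P A_𝔮` of `TieFinite.finite_tiePrimes` (p548769) read at the point.
(`ν` itself: `Iota3.iotaOrd_germ_eq_iotaOrd_localization`, p530533.)

[OURS] Replaces the role of NO printed item; NOT a statement of the manuscript under review [claim: Hironaka2017, status:
under-review].  AI work, weaker than expert review.  Def-free.

## References

* A. Grothendieck, EGA I 1.3 (stalks of affine schemes are localisations). [folklore]
-/

noncomputable section

set_option linter.dupNamespace false -- mandated namespace `Summit.<Summit>.<Problem>` of this single-conjunct summit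

open CategoryTheory AlgebraicGeometry TopologicalSpace IsLocalRing
open Literature.AlgebraicGeometry.Resolution
open Summit.ResolutionOfSingularities.ResolutionOfSingularities.Theorems

namespace Summit.ResolutionOfSingularities.ResolutionOfSingularities.Cruxes.HypersurfaceCentreConstruction.LocalEngine

namespace TieFinite

section Chart

variable {Y : Scheme.{0}} (U : Y.affineOpens)

/-- The germ of `f` at `y ∈ U` is the image of `f|_U / 1` under `stalkEquiv`. [folklore] -/
theorem stalkEquiv_algebraMap_res (f : Γ(Y, ⊤)) {y : Y} (hy : y ∈ (U : Y.Opens)) :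
    stalkEquiv U hy (algebraMap Γ(Y, U) (Localization.AtPrime (U.2.primeIdealOf ⟨y, hy⟩).asIdeal)
      (Y.presheaf.map (homOfLE le_top).op f)) = (Y.presheaf.germ ⊤ y trivial) f := by
  rw [stalkEquiv_algebraMap]
  exact TopCat.Presheaf.germ_res_apply Y.presheaf (homOfLE le_top) y hy f

/-- **Iso-invariant predicates on the chart**: `P (𝒪_{Y,y}) (f_y) ↔ P (Γ(Y,U)_{𝔭_y}) (f|_U / 1)`. [folklore] -/
theorem isoInvariant_germ_iff_localization (P : (R : Type) → [CommRing R] → R → Prop)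
    (hP : ∀ (R T : Type) [CommRing R] [CommRing T] (e : R ≃+* T) (g : R), P R g ↔ P T (e g))
    (f : Γ(Y, ⊤)) {y : Y} (hy : y ∈ (U : Y.Opens)) :
    P (Y.presheaf.stalk y) ((Y.presheaf.germ ⊤ y trivial) f) ↔
      P (Localization.AtPrime (U.2.primeIdealOf ⟨y, hy⟩).asIdeal)
        (algebraMap Γ(Y, U) (Localization.AtPrime (U.2.primeIdealOf ⟨y, hy⟩).asIdeal)
          (Y.presheaf.map (homOfLE le_top).op f)) := by
  rw [← stalkEquiv_algebraMap_res U f hy]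
  exact (hP _ _ (stalkEquiv U hy) _).symm

/-- **Tie positions on the chart**: `IsTiePosition 𝒪_{Y,y} f_y ↔ IsTiePosition Γ(Y,U)_{𝔭_y} (f|_U/1)`. [OURS] -/
theorem isTiePosition_germ_iff_localization (f : Γ(Y, ⊤)) {y : Y} (hy : y ∈ (U : Y.Opens)) :
    Iota3.IsTiePosition (Y.presheaf.stalk y) ((Y.presheaf.germ ⊤ y trivial) f) ↔
      Iota3.IsTiePosition (Localization.AtPrime (U.2.primeIdealOf ⟨y, hy⟩).asIdeal)
        (algebraMap Γ(Y, U) (Localization.AtPrime (U.2.primeIdealOf ⟨y, hy⟩).asIdeal)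
          (Y.presheaf.map (homOfLE le_top).op f)) :=
  isoInvariant_germ_iff_localization U (fun R _ g => Iota3.IsTiePosition R g)
    (fun _ _ _ _ e g => (Iota3.isTiePosition_ringEquiv_iff e g).symm) f hy

/-- The same at a point `fromSpec q` of the chart. [OURS] -/
theorem isTiePosition_germ_fromSpec_iff (f : Γ(Y, ⊤)) (q : PrimeSpectrum Γ(Y, U)) :
    Iota3.IsTiePosition (Y.presheaf.stalk (U.2.fromSpec q)) ((Y.presheaf.germ ⊤ (U.2.fromSpec q) trivial) f) ↔
      Iota3.IsTiePosition (Localization.AtPrime q.asIdeal)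
        (algebraMap Γ(Y, U) (Localization.AtPrime q.asIdeal) (Y.presheaf.map (homOfLE le_top).op f)) := by
  rw [isTiePosition_germ_iff_localization U f (Iota3.fromSpec_mem U q), Iota3.primeIdealOf_fromSpec U q (Iota3.fromSpec_mem U q)]

/-- Membership in powers of the maximal ideal on the chart: `f_y ∈ 𝔪_y^n ↔ f|_U/1 ∈ 𝔪_{𝔭_y}^n`. [folklore] -/
theorem germ_mem_pow_iff_localization (f : Γ(Y, ⊤)) {y : Y} (hy : y ∈ (U : Y.Opens)) (n : ℕ) :
    (Y.presheaf.germ ⊤ y trivial) f ∈ maximalIdeal (Y.presheaf.stalk y) ^ n ↔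
      algebraMap Γ(Y, U) (Localization.AtPrime (U.2.primeIdealOf ⟨y, hy⟩).asIdeal) (Y.presheaf.map (homOfLE le_top).op f) ∈
        maximalIdeal (Localization.AtPrime (U.2.primeIdealOf ⟨y, hy⟩).asIdeal) ^ n := by
  rw [← le_adicOrder_iff, ← le_adicOrder_iff, ← stalkEquiv_algebraMap_res U f hy, adicOrder_map_ringEquiv]

/-- **The stratum prime on the chart**: for an ideal `P′ ⊆ Γ(Y, U)`,
`topStratumPrime ι₀ 𝒪_{Y,y} f_y = P′ · 𝒪_{Y,y} ↔ topStratumPrime ι₀ Γ(Y,U)_{𝔭_y} (f|_U/1) = P′ · Γ(Y,U)_{𝔭_y}`. [OURS] -/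
theorem topStratumPrime_germ_eq_map_iff (f : Γ(Y, ⊤)) {y : Y} (hy : y ∈ (U : Y.Opens)) (P' : Ideal Γ(Y, U)) :
    letI := TopCat.Presheaf.algebra_section_stalk Y.presheaf (⟨y, hy⟩ : (U : Y.Opens))
    ContactCylinder.topStratumPrime Iota3.iotaOrdEps (Y.presheaf.stalk y) ((Y.presheaf.germ ⊤ y trivial) f) =
        P'.map (algebraMap Γ(Y, U) (Y.presheaf.stalk y)) ↔
      ContactCylinder.topStratumPrime Iota3.iotaOrdEps (Localization.AtPrime (U.2.primeIdealOf ⟨y, hy⟩).asIdeal)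
          (algebraMap Γ(Y, U) (Localization.AtPrime (U.2.primeIdealOf ⟨y, hy⟩).asIdeal) (Y.presheaf.map (homOfLE le_top).op f)) =
        P'.map (algebraMap Γ(Y, U) (Localization.AtPrime (U.2.primeIdealOf ⟨y, hy⟩).asIdeal)) := by
  letI := TopCat.Presheaf.algebra_section_stalk Y.presheaf (⟨y, hy⟩ : (U : Y.Opens))
  set e := stalkEquiv U hy with he
  -- the structure map to the stalk factors through `e`
  have hcomp : (e : Localization.AtPrime (U.2.primeIdealOf ⟨y, hy⟩).asIdeal →+* Y.presheaf.stalk y).comp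
      (algebraMap Γ(Y, U) (Localization.AtPrime (U.2.primeIdealOf ⟨y, hy⟩).asIdeal)) = algebraMap Γ(Y, U) (Y.presheaf.stalk y) := by
    ext F
    rw [RingHom.comp_apply, RingHom.coe_coe, he, stalkEquiv_algebraMap]
    rfl
  have hmap : P'.map (algebraMap Γ(Y, U) (Y.presheaf.stalk y)) =
      (P'.map (algebraMap Γ(Y, U) (Localization.AtPrime (U.2.primeIdealOf ⟨y, hy⟩).asIdeal))).map
        (e : Localization.AtPrime (U.2.primeIdealOf ⟨y, hy⟩).asIdeal →+* Y.presheaf.stalk y) := by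
    rw [Ideal.map_map, hcomp]
  rw [← stalkEquiv_algebraMap_res U f hy, ← he,
    ContactCylinder.topStratumPrime_ringEquiv Iota3.iotaOrdEps e Iota3.iotaOrdEps_isoInvariant _, hmap,
    Iota3.comap_symm_eq_map]
  constructor
  · intro h
    have h' := congrArg (Ideal.map (e.symm : Y.presheaf.stalk y →+* Localization.AtPrime (U.2.primeIdealOf ⟨y, hy⟩).asIdeal)) h
    rwa [Ideal.map_map, Ideal.map_map, RingEquiv.symm_comp, Ideal.map_id, Ideal.map_id] at h'
  · intro h
    rw [h]

end Chart

end TieFinite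

end Summit.ResolutionOfSingularities.ResolutionOfSingularities.Cruxes.HypersurfaceCentreConstruction.LocalEngine

end
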